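import Summits.Ventures.HSemireg.SignedPureWeilAngles
import Summits.Ventures.HSemireg.SignedPureWeilTransport

/-!
# Venture HSemireg — LINEAR CERTIFICATES for the axis classes of signed pure-Weil designs (every n): a ℤ[i]-combination of VISIBLE
# characters that agrees with D·(i^{|x|} ± i^{−|x|}) on the support of a pure design forces Re W = 0 ∕ Im W = 0; the axis class is
# invariant under the symmetry group Γₙ

HONEST FRAMING. Part of the Lean index of the computation cell `pub-hsemireg` (Sunday typer seat p9, § g = 8; family B row **B20-3**
of `target-g8/CENSUS.md`: signed pure-Weil unit-graph designs are «class witnesses — cycles with ℤ-coefficients — not census objects»).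
FINITE GAUSSIAN-INTEGER ARITHMETIC ONLY, in the vocabulary of `SignedPureWeilLadder.lean` (`Letter`, `Eps`, `vchi`, `vmoment`, `plus`,
`minus`, `supp`, `unitTab`), `SignedPureWeilTransport.lean` (`shift`, `permute`, `reflect`, `transport`, `vmoment_minus_eq_star`) and
`SignedPureWeilAngles.lean` (`IsAxis`). No abelian variety, cycle, sheaf or semiregularity map is constructed; nothing here says that
HC ∕ HC_CM ∕ HC_AV holds; no object is certified; no Literature fact is declared; no verdict ∕ door word ∕ count of the cell moves.
EVERYTHING HERE IS UNCONDITIONAL and general in n; the users are `SignedPureWeilAxisCertificatesN4.lean` + `SignedPureWeilAxis31.lean`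
(the 140 orbit representatives of the level-4 census ⇒ AXIS31 modulo its completeness) and `SignedPureWeilAxisLevel2.lean` (all pure
designs on (ℤ∕4)² with ≤ 5 letters ⇒ s(3) ≥ 12, …, s(6) ≥ 96 unconditionally).

CONTENT. `lcomb L x = Σ_{(ε,a) ∈ L} a·i^{ε·x}` for a coefficient list `L`; `sum_lcomb_mul` (pairing against a design gives the same
combination of moments); `sum_lcomb_mul_of_pure` (a combination of VISIBLE characters pairs to 0 against a pure design);
**`re_eq_zero_of_lcert`** ∕ **`im_eq_zero_of_lcert`** (if the combination agrees with `D·(i^{|x|} + i^{−|x|})`, resp.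
`D·(i^{|x|} − i^{−|x|})`, at every support letter and D ≠ 0, then Re W = 0, resp. Im W = 0 — the right-hand side pairs to
`D·(W ± conj W)`); `isAxis_unitTab_mul_iff`, `isAxis_star_iff`, **`isAxis_transport_iff`** (the Weil moment of a transported design
is a unit times the original one or its conjugate). Record file of the angle route: `HOME/p9/S5-ANGLE-p9g9.md`.
-/

namespace Summit.Ventures.HSemireg.SignedWeilDesignN

open Finset

variable {n : ℕ}

/-! ## §1 Linear certificates for the axis classes (every n) -/

/-- The character combination `Σ_{(ε,a) ∈ L} a·i^{ε·x}` of a finite coefficient list. [definition of this file] -/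
def lcomb (L : List (Eps n × GaussianInt)) (x : Letter n) : GaussianInt := (L.map fun p => p.2 * vchi p.1 x).sum

/-- Pairing a character combination against a design gives the same combination of its moments. -/
theorem sum_lcomb_mul (L : List (Eps n × GaussianInt)) (m : Letter n → ℤ) :
    (∑ x, lcomb L x * (m x : GaussianInt)) = (L.map fun p => p.2 * vmoment m p.1).sum := by
  induction L with
  | nil => simp [lcomb]
  | cons p L ih =>
    simp only [lcomb, List.map_cons, List.sum_cons] at ih ⊢
    rw [← ih]
    simp only [add_mul, Finset.sum_add_distrib]
    congr 1
    rw [vmoment, Finset.mul_sum]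
    refine Finset.sum_congr rfl (fun x _ => ?_)
    ring

/-- Against a PURE design a combination of VISIBLE characters pairs to zero. -/
theorem sum_lcomb_mul_of_pure (L : List (Eps n × GaussianInt)) (hvis : ∀ p ∈ L, p.1 ≠ plus ∧ p.1 ≠ minus)
    (m : Letter n → ℤ) (hpure : ∀ ε : Eps n, ε ≠ plus → ε ≠ minus → vmoment m ε = 0) :
    (∑ x, lcomb L x * (m x : GaussianInt)) = 0 := by
  rw [sum_lcomb_mul]
  have : (L.map fun p => p.2 * vmoment m p.1) = L.map fun _ => 0 := by
    refine List.map_congr_left (fun p hp => ?_)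
    rw [hpure p.1 (hvis p hp).1 (hvis p hp).2, mul_zero]
  rw [this]
  simp

/-- **REAL-PART CERTIFICATE.** If a combination of visible characters agrees with `D·(i^{|x|} + i^{−|x|})` on the support of a pure
design `m` (D ≠ 0), then `Re W(m) = 0`. -/
theorem re_eq_zero_of_lcert (L : List (Eps n × GaussianInt)) (hvis : ∀ p ∈ L, p.1 ≠ plus ∧ p.1 ≠ minus) (D : ℤ) (hD : D ≠ 0)
    (m : Letter n → ℤ) (hpure : ∀ ε : Eps n, ε ≠ plus → ε ≠ minus → vmoment m ε = 0)
    (hvan : ∀ x, m x ≠ 0 → lcomb L x = (D : GaussianInt) * (vchi plus x + vchi minus x)) :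
    (vmoment m plus).re = 0 := by
  have h0 := sum_lcomb_mul_of_pure L hvis m hpure
  have h1 : (∑ x, lcomb L x * (m x : GaussianInt)) = (D : GaussianInt) * (vmoment m plus + vmoment m minus) := by
    rw [vmoment, vmoment, ← Finset.sum_add_distrib, Finset.mul_sum]
    refine Finset.sum_congr rfl (fun x _ => ?_)
    by_cases hx : m x = 0
    · simp [hx]
    · rw [hvan x hx]; ring
  rw [h1, vmoment_minus_eq_star] at h0
  rcases mul_eq_zero.mp h0 with h | h
  · exact absurd (by exact_mod_cast h) hD
  · have := congrArg Zsqrtd.re h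
    simp at this
    omega

/-- **IMAGINARY-PART CERTIFICATE.** If a combination of visible characters agrees with `D·(i^{|x|} − i^{−|x|})` on the support of a
pure design `m` (D ≠ 0), then `Im W(m) = 0`. -/
theorem im_eq_zero_of_lcert (L : List (Eps n × GaussianInt)) (hvis : ∀ p ∈ L, p.1 ≠ plus ∧ p.1 ≠ minus) (D : ℤ) (hD : D ≠ 0)
    (m : Letter n → ℤ) (hpure : ∀ ε : Eps n, ε ≠ plus → ε ≠ minus → vmoment m ε = 0)
    (hvan : ∀ x, m x ≠ 0 → lcomb L x = (D : GaussianInt) * (vchi plus x - vchi minus x)) :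
    (vmoment m plus).im = 0 := by
  have h0 := sum_lcomb_mul_of_pure L hvis m hpure
  have h1 : (∑ x, lcomb L x * (m x : GaussianInt)) = (D : GaussianInt) * (vmoment m plus - vmoment m minus) := by
    rw [vmoment, vmoment, ← Finset.sum_sub_distrib, Finset.mul_sum]
    refine Finset.sum_congr rfl (fun x _ => ?_)
    by_cases hx : m x = 0
    · simp [hx]
    · rw [hvan x hx]; ring
  rw [h1, vmoment_minus_eq_star] at h0
  rcases mul_eq_zero.mp h0 with h | h
  · exact absurd (by exact_mod_cast h) hD
  · have := congrArg Zsqrtd.im h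
    simp at this
    omega

/-- Multiplication by a power of `i` preserves the axis class. -/
theorem isAxis_unitTab_mul_iff (u : Fin 4) (z : GaussianInt) : IsAxis (unitTab u * z) ↔ IsAxis z := by
  unfold IsAxis
  fin_cases u <;> simp [unitTab] <;> omega

/-- Conjugation preserves the axis class. -/
theorem isAxis_star_iff (z : GaussianInt) : IsAxis (star z) ↔ IsAxis z := by
  unfold IsAxis
  rw [Zsqrtd.re_star, Zsqrtd.im_star, neg_eq_zero]

/-- **THE AXIS CLASS IS Γ-INVARIANT:** the Weil moment of a transported design is axis iff the original one is. -/
theorem isAxis_transport_iff (m : Letter n → ℤ) (t : Letter n) (σ : Equiv.Perm (Fin n)) (s : Bool) :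
    IsAxis (vmoment (transport m t σ s) plus) ↔ IsAxis (vmoment m plus) := by
  have hps : (plus : Eps n) ∘ σ = plus := rfl
  have hsw : swapCode ∘ (plus : Eps n) = minus := rfl
  rw [transport_eq]
  cases s
  · simp only [Bool.false_eq_true, ↓reduceIte]
    rw [vmoment_permute, hps, vmoment_shift, vchi, isAxis_unitTab_mul_iff]
  · simp only [↓reduceIte]
    rw [vmoment_permute, hps, vmoment_reflect, vmoment_shift, hsw, vmoment_minus_eq_star, vchi, isAxis_unitTab_mul_iff,
      isAxis_star_iff]

end Summit.Ventures.HSemireg.SignedWeilDesignN
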